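import Summits.Ventures.PercRepro.RankLevelSetLocalSparse
import Summits.Ventures.PercRepro.RankLevelSetBinomialTail
import Summits.Ventures.PercRepro.RankLevelSetFrameQ

/-!
# PercRepro — THEOREM C∞, the core: C-025 on the `e`-free core of rank `p ≥ P(q)` at EVERY corank `> 2q + 2^q`
(night-1, gen 3)

`proofs/NIGHT-1-C025-induction.md` §14. Theorem C (`exists_N₀_c025_simple`, `exists_P_c025_bounded`) needs a BOUNDED
corank `|E| − p ≤ D`. Here the corank is unbounded: on the core of the `|E|`-induction wrapper — rank `p`, every
element with an `e`-free partition (hence loopless and LOCALLY SPARSE: a rank-`k` set has `≤ 2^k − 1` points,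
`RankLevelSetLocalSparse`) — two counting regimes give `Φ(p, q)·#U ≤ #Y` for every `p ≥ P(q)` and every
`n = |E| > p + 2q + 2^q`:

* REGIME I (`n ≤ 2p − 1`): `#U ≤ C(n, q)·2^{2^q − 1}` and `C(n, q) ≤ 2^q C(p+q, q)` give `Φ·#U ≤ 2^{p + 2q + 2^q − 1}
  ≤ 2^{n−2}`; `#{r ≤ q} ≤ Σ_{j < 2^q} C(n, j) ≤ 2^{n−3}` (`n ≥ N₁`) and `#{spanning} ≤ Σ_{j ≤ n−p} C(n, j) ≤ 2^{n−1}`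
  (`2(n − p) + 1 ≤ n`), so `#Y ≥ 2^n − 2^{n−3} − 2^{n−1} ≥ 2^{n−2}` (`coreLarge_arith_I`);
* REGIME II (`n ≥ 2p`): `#Y ≥ C(n, p − 1)` (every `(p−1)`-set has rank in `(q, p)` once `2^q ≤ p − 1`) and
  `2^{p+q}·2^{2^q − 1}·C(n, q) ≤ C(n, p − 1)` (`choose_le_choose_mul_of_threshold`, threshold `p ≥ P₂`)
  (`coreLarge_arith_II`).
`exists_P_core_all_corank` is the core statement the wrapper `rls_succ_large` (`RankLevelSetFrameLarge`) consumes.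
Axioms: standard.
-/

open scoped Matroid

namespace PercRepro

namespace ThmN

open Set

variable {α : Type}

/-- **Regime I arithmetic** (`n ≤ 2p − 1`, `n ≥ p + 2q + 2^q + 1`): from `Φ ≤ 2^{p+q}/C(p+q, p)`,
`U ≤ C(n, q)·2^{2^q − 1}`, `C(n, q) ≤ 2^q C(p+q, p)`, `2^n ≤ Y + A + B`, `A ≤ 2^{n−3}`, `B ≤ 2^{n−1}`: `Φ·U ≤ Y`. -/
theorem coreLarge_arith_I {n p q : ℕ} {Φ U Y A B : ℚ} (hq : 2 ≤ q)
    (hn : p + (2 * q + 2 ^ q) + 1 ≤ n)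
    (hΦ : Φ ≤ (2 ^ (p + q) : ℚ) / ((p + q).choose p : ℚ)) (hU0 : 0 ≤ U)
    (hU : U ≤ (n.choose q : ℚ) * 2 ^ (2 ^ q - 1))
    (hCn : (n.choose q : ℚ) ≤ 2 ^ q * ((p + q).choose p : ℚ))
    (hY : (2 : ℚ) ^ n ≤ Y + A + B) (hA : A ≤ 2 ^ (n - 3)) (hB : B ≤ 2 ^ (n - 1)) : Φ * U ≤ Y := by
  have hc : (0 : ℚ) < ((p + q).choose p : ℚ) := by exact_mod_cast Nat.choose_pos (Nat.le_add_right p q)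
  have hq1 : 1 ≤ 2 ^ q := Nat.one_le_two_pow
  have h1 : Φ * U ≤ (2 ^ (p + q) : ℚ) / ((p + q).choose p : ℚ) * ((n.choose q : ℚ) * 2 ^ (2 ^ q - 1)) :=
    mul_le_mul hΦ hU hU0 (by positivity)
  have h2 : (2 ^ (p + q) : ℚ) / ((p + q).choose p : ℚ) * ((n.choose q : ℚ) * 2 ^ (2 ^ q - 1)) ≤
      2 ^ (p + q) * 2 ^ q * 2 ^ (2 ^ q - 1) := by
    rw [div_mul_eq_mul_div, div_le_iff₀ hc]
    calc (2 ^ (p + q) : ℚ) * ((n.choose q : ℚ) * 2 ^ (2 ^ q - 1))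
        ≤ 2 ^ (p + q) * ((2 ^ q * ((p + q).choose p : ℚ)) * 2 ^ (2 ^ q - 1)) := by gcongr
      _ = 2 ^ (p + q) * 2 ^ q * 2 ^ (2 ^ q - 1) * ((p + q).choose p : ℚ) := by ring
  have h3 : (2 : ℚ) ^ (p + q) * 2 ^ q * 2 ^ (2 ^ q - 1) ≤ 2 ^ (n - 2) := by
    rw [← pow_add, ← pow_add]
    exact pow_le_pow_right₀ (by norm_num) (by omega)
  have e3 : (2 : ℚ) ^ n = 2 ^ (n - 3) * 8 := by
    rw [show (8 : ℚ) = 2 ^ 3 by norm_num, ← pow_add]; congr 1; omega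
  have e2 : (2 : ℚ) ^ (n - 2) = 2 ^ (n - 3) * 2 := by
    rw [← pow_succ]; congr 1; omega
  have e1 : (2 : ℚ) ^ (n - 1) = 2 ^ (n - 3) * 4 := by
    rw [show (4 : ℚ) = 2 ^ 2 by norm_num, ← pow_add]; congr 1; omega
  have hΦU : Φ * U ≤ 2 ^ (n - 3) * 2 := by rw [← e2]; exact h1.trans (h2.trans h3)
  have hX : (0 : ℚ) ≤ 2 ^ (n - 3) := by positivity
  rw [e3] at hY
  rw [e1] at hB
  linarith

/-- **Regime II arithmetic** (`n ≥ 2p`): from `Φ ≤ 2^{p+q}/C(p+q, p)`, `U ≤ C(n, q)·K`,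
`2^{p+q}·K·C(n, q) ≤ C(n, p − 1)` and `C(n, p − 1) ≤ Y`: `Φ·U ≤ Y`. -/
theorem coreLarge_arith_II {n p q K : ℕ} {Φ U Y : ℚ}
    (hΦ : Φ ≤ (2 ^ (p + q) : ℚ) / ((p + q).choose p : ℚ)) (hU0 : 0 ≤ U)
    (hU : U ≤ (n.choose q : ℚ) * K)
    (hkey : 2 ^ (p + q) * K * n.choose q ≤ n.choose (p - 1))
    (hY : (n.choose (p - 1) : ℚ) ≤ Y) : Φ * U ≤ Y := by
  have hc : (1 : ℚ) ≤ ((p + q).choose p : ℚ) := by exact_mod_cast Nat.choose_pos (Nat.le_add_right p q)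
  have hΦ' : Φ ≤ (2 ^ (p + q) : ℚ) := hΦ.trans (div_le_self (by positivity) hc)
  have hkey' : (2 : ℚ) ^ (p + q) * K * (n.choose q : ℚ) ≤ (n.choose (p - 1) : ℚ) := by exact_mod_cast hkey
  calc Φ * U ≤ (2 ^ (p + q) : ℚ) * ((n.choose q : ℚ) * K) := mul_le_mul hΦ' hU hU0 (by positivity)
    _ = 2 ^ (p + q) * K * (n.choose q : ℚ) := by ring
    _ ≤ (n.choose (p - 1) : ℚ) := hkey'
    _ ≤ Y := hY

/-- **THEOREM C∞, THE CORE, WITH EXPLICIT THRESHOLDS**: if `N₁` and `P₂` satisfy `8·2^q·n^{2^q − 1} ≤ 2^n` for all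
`n ≥ N₁` and `2^{2^q − 1}·2^{3q+3}·p^{q+1} ≤ 2^p` for all `p ≥ P₂`, then every finite matroid of rank
`p ≥ max N₁ P₂ (2^q + 2)` in which every element admits an `e`-free partition satisfies `Φ(p, q)·#U(p, q) ≤ #Y(p, q)`
whenever `|E| > p + 2q + 2^q` — at EVERY corank beyond `2q + 2^q`, uniformly. -/
theorem core_all_corank_of_thresholds (q : ℕ) (hq : 2 ≤ q) (N₁ P₂ : ℕ)
    (hN₁ : ∀ n, N₁ ≤ n → 8 * 2 ^ q * n ^ (2 ^ q - 1) ≤ 2 ^ n)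
    (hP₂ : ∀ n, P₂ ≤ n → 2 ^ (2 ^ q - 1) * 2 ^ (3 * q + 3) * n ^ (q + 1) ≤ 2 ^ n) :
    ∀ {α : Type} (M : Matroid α) [M.Finite] (p : ℕ), max (max N₁ P₂) (2 ^ q + 2) ≤ p → M.eRank = (p : ℕ∞) →
      p + (2 * q + 2 ^ q) < M.E.ncard →
      (∀ e ∈ M.E, ∃ A ⊆ M.E \ {e}, e ∉ M.closure A ∧ e ∉ M.closure ((M.E \ {e}) \ A)) → RLS M p q := by
  classical
  intro α M _ p hP hR hbig hfree
  set n := M.E.ncard with hn_def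
  have hEcard : M.ground_finite.toFinset.card = n := by
    rw [hn_def, Set.ncard_eq_toFinset_card _ M.ground_finite]
  have hq2 : 2 * q ≤ 2 ^ q := by
    have : q ≤ 2 ^ (q - 1) := by
      calc q = (q - 1) + 1 := by omega
        _ ≤ 2 ^ (q - 1) := Nat.lt_two_pow_self
    calc 2 * q ≤ 2 * 2 ^ (q - 1) := by omega
      _ = 2 ^ (q - 1 + 1) := by ring
      _ = 2 ^ q := by congr 1; omega
  have hpP : 2 ^ q + 2 ≤ p := le_trans (le_max_right _ _) hP
  have hN₁p : N₁ ≤ p := le_trans (le_max_left _ _) (le_trans (le_max_left _ _) hP)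
  have hP₂p : P₂ ≤ p := le_trans (le_max_right _ _) (le_trans (le_max_left _ _) hP)
  have hpn : p ≤ n := by omega
  -- (U): `#U ≤ C(n, q) · 2^{2^q − 1}`
  have hU : Matroid.topCount M p q ≤ n.choose q * 2 ^ (2 ^ q - 1) := by
    calc Matroid.topCount M p q ≤ Matroid.levelCount M q := Matroid.topCount_le_levelCount_bot p q
      _ = {X : Set α | X ⊆ M.E ∧ M.eRk X = q}.ncard := rfl
      _ ≤ n.choose q * 2 ^ (2 ^ q - 1) := by rw [← hEcard]; exact ncard_eRk_eq_le_choose_mul M hfree q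
  have hΦ := phiK_le_two_pow_div p q
  have hU0 : (0 : ℚ) ≤ (Matroid.topCount M p q : ℚ) := by positivity
  have hUq : (Matroid.topCount M p q : ℚ) ≤ (n.choose q : ℚ) * 2 ^ (2 ^ q - 1) := by exact_mod_cast hU
  rw [RLS_iff]
  rcases Nat.lt_or_ge n (2 * p) with hsmall | hlarge
  · -- REGIME I: `n ≤ 2p − 1`
    have hd : M.E.encard = M.eRank + ((n - p : ℕ) : ℕ∞) := by
      rw [hR, ← M.ground_finite.cast_ncard_eq]
      norm_cast
      omega
    have hY := Matroid.two_pow_le_midCount_add (M := M) p q hR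
    have hA := ncard_eRk_le_le_sum_choose M hfree q
    have hB := Matroid.ncard_spanning_le (M := M) hd
    rw [hEcard] at hY hA hB
    -- `A ≤ 2^{n−3}`
    have hA' : ∑ j ∈ Finset.range (2 ^ q - 1 + 1), n.choose j ≤ 2 ^ (n - 3) := by
      have h1 := sum_choose_le_mul_pow n (2 ^ q - 1) (by omega)
      have h2 := hN₁ n (by omega)
      have h3 : 2 ^ n = 2 ^ (n - 3) * 8 := by
        rw [show (8 : ℕ) = 2 ^ 3 by norm_num, ← pow_add]; congr 1; omega
      have h4 : 2 ^ q - 1 + 1 = 2 ^ q := by have := Nat.one_le_two_pow (n := q); omega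
      rw [h4] at h1 ⊢
      have h5 : 8 * (2 ^ q * n ^ (2 ^ q - 1)) ≤ 8 * 2 ^ (n - 3) := by
        calc 8 * (2 ^ q * n ^ (2 ^ q - 1)) = 8 * 2 ^ q * n ^ (2 ^ q - 1) := by ring
          _ ≤ 2 ^ n := h2
          _ = 8 * 2 ^ (n - 3) := by rw [h3]; ring
      exact h1.trans (Nat.le_of_mul_le_mul_left h5 (by norm_num))
    -- `B ≤ 2^{n−1}`
    have hB' : ∑ j ∈ Finset.range (n - p + 1), n.choose j ≤ 2 ^ (n - 1) :=
      sum_choose_le_two_pow_pred n (n - p) (by omega)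
    -- `C(n, q) ≤ 2^q C(p+q, p)`
    have hCn : n.choose q ≤ 2 ^ q * (p + q).choose p := by
      rw [Nat.choose_symm_add]
      exact choose_le_two_pow_mul_choose n p q (by omega)
    -- to `ℚ`
    have hYq : (2 : ℚ) ^ n ≤ (Matroid.midCount M p q : ℚ) + ({X : Set α | X ⊆ M.E ∧ M.eRk X ≤ q}.ncard : ℚ) +
        ({X : Set α | X ⊆ M.E ∧ M.eRk X = M.eRank}.ncard : ℚ) := by exact_mod_cast hY
    have hAq : ({X : Set α | X ⊆ M.E ∧ M.eRk X ≤ q}.ncard : ℚ) ≤ 2 ^ (n - 3) := by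
      exact_mod_cast hA.trans hA'
    have hBq : ({X : Set α | X ⊆ M.E ∧ M.eRk X = M.eRank}.ncard : ℚ) ≤ 2 ^ (n - 1) := by
      exact_mod_cast hB.trans hB'
    have hCnq : (n.choose q : ℚ) ≤ 2 ^ q * ((p + q).choose p : ℚ) := by exact_mod_cast hCn
    exact coreLarge_arith_I hq (by omega) hΦ hU0 hUq hCnq hYq hAq hBq
  · -- REGIME II: `n ≥ 2p`
    have hY := choose_le_midCount_of_two_pow_le M hfree (p := p) (q := q) (by omega) (by omega)
    rw [hEcard] at hY
    have hT : 2 ^ (p + q) * 2 ^ (2 ^ q - 1) * (2 * p ^ (q + 1)) ≤ 4 ^ (p - 1 - q) := by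
      have e1 : 4 ^ (p - 1 - q) = 2 ^ p * 2 ^ (p - 2 - 2 * q) := by
        rw [show (4 : ℕ) = 2 ^ 2 by norm_num, ← pow_mul, ← pow_add]; congr 1; omega
      have e2 : 2 ^ (p + q) * 2 ^ (2 ^ q - 1) * (2 * p ^ (q + 1)) =
          (2 ^ (2 ^ q - 1) * 2 ^ (3 * q + 3) * p ^ (q + 1)) * 2 ^ (p - 2 - 2 * q) := by
        have e3 : 2 ^ (3 * q + 3) * 2 ^ (p - 2 - 2 * q) = 2 ^ (p + q + 1) := by
          rw [← pow_add]; congr 1; omega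
        calc 2 ^ (p + q) * 2 ^ (2 ^ q - 1) * (2 * p ^ (q + 1))
            = 2 ^ (2 ^ q - 1) * p ^ (q + 1) * (2 ^ (p + q) * 2) := by ring
          _ = 2 ^ (2 ^ q - 1) * p ^ (q + 1) * 2 ^ (p + q + 1) := by ring
          _ = 2 ^ (2 ^ q - 1) * p ^ (q + 1) * (2 ^ (3 * q + 3) * 2 ^ (p - 2 - 2 * q)) := by rw [e3]
          _ = (2 ^ (2 ^ q - 1) * 2 ^ (3 * q + 3) * p ^ (q + 1)) * 2 ^ (p - 2 - 2 * q) := by ring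
      rw [e1, e2]
      exact Nat.mul_le_mul_right _ (hP₂ p hP₂p)
    have hkey := choose_le_choose_mul_of_threshold n p q (2 ^ (2 ^ q - 1)) (by omega) hlarge hT
    have hYq : (n.choose (p - 1) : ℚ) ≤ (Matroid.midCount M p q : ℚ) := by exact_mod_cast hY
    have hUq' : (Matroid.topCount M p q : ℚ) ≤ (n.choose q : ℚ) * ((2 ^ (2 ^ q - 1) : ℕ) : ℚ) := by
      exact_mod_cast hU
    exact coreLarge_arith_II hΦ hU0 hUq' hkey hYq

/-- **THEOREM C∞, THE CORE**: for every `q ≥ 2` there is `P` such that every finite matroid of rank `p ≥ P` in which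
every element admits an `e`-free partition satisfies `Φ(p, q)·#U(p, q) ≤ #Y(p, q)` whenever `|E| > p + 2q + 2^q` —
at EVERY corank beyond `2q + 2^q`, uniformly (the thresholds from `exists_forall_mul_pow_le_two_pow`). -/
theorem exists_P_core_all_corank (q : ℕ) (hq : 2 ≤ q) :
    ∃ P : ℕ, ∀ {α : Type} (M : Matroid α) [M.Finite] (p : ℕ), P ≤ p → M.eRank = (p : ℕ∞) →
      p + (2 * q + 2 ^ q) < M.E.ncard →
      (∀ e ∈ M.E, ∃ A ⊆ M.E \ {e}, e ∉ M.closure A ∧ e ∉ M.closure ((M.E \ {e}) \ A)) → RLS M p q := by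
  obtain ⟨N₁, hN₁⟩ := exists_forall_mul_pow_le_two_pow (8 * 2 ^ q) (2 ^ q - 1)
  obtain ⟨P₂, hP₂⟩ := exists_forall_mul_pow_le_two_pow (2 ^ (2 ^ q - 1) * 2 ^ (3 * q + 3)) (q + 1)
  exact ⟨max (max N₁ P₂) (2 ^ q + 2), fun M _ p hP hR hbig hfree =>
    core_all_corank_of_thresholds q hq N₁ P₂ hN₁ hP₂ M p hP hR hbig hfree⟩

end ThmN

end PercRepro
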